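import Summits.BirchSwinnertonDyer.Rank1Residual.AdditivePotMult.EigenLeadingTermThree
import Summits.BirchSwinnertonDyer.Rank1Residual.AdditivePotMult.PStarTwistModel
import Summits.BirchSwinnertonDyer.Rank1Residual.Additive.ChiBranchInputBigImageEven
import Summits.BirchSwinnertonDyer.Rank1Residual.Additive.ChiEigenPrimeToPDescentGenerator
import Summits.BirchSwinnertonDyer.Rank1Residual.Additive.XMultRankZeroCyclotomicPrimePrep
import Literature.NumberTheory.QuadraticFields.FundamentalDiscriminant
import Literature.NumberTheory.EllipticCurves.PAdicLFunctionBranch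
import HarnessLib

/-!
# (M) brick 5′, preparations: the `F`-level eigen datum as a Literature datum, the fields `ℚ(√p*)`,
# `ℚ(ζ_p)`, and the half branch of a `p`-multiplicative curve with its value at `T = 0`
# (cell `b2b-bsdres`, seat additive-p1, gen 9; consumer: `PotMultChiBranchPrime.lean`)

HONEST FRAMING (cell `b2b-bsdres`, run/shared/lean/b2b/bsd-rank1-residual/, verbatim in every
file): the goal of the cell is to DELETE the COMBINATION-SHAPED residual classes of the
Birch–Swinnerton-Dyer formula for ALL analytic-rank `≤ 1` elliptic curves over `ℚ` — "full BSD
formula for every rank `≤ 1` curve in class `C`" assembled STRICTLY from published theorems — so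
that the rank-`≤ 1` remainder becomes exactly the CONSTRUCTION-SHAPED classes, which are TYPED
(missing-input `Prop`s), NOT attempted. This is not "finishing BSD". Sub-cell additive-p1
(X3♯(M) / X4(M)); labels UNCHANGED by this file; nothing is booked.

Theorems + one conversion `def` (`ChiEigenSelmerInDualData.toEigen`, field-for-field, SAME carrier);
no named fact. Pieces used by `PotMultChiBranchPrime.lean` ((M) brick 5′ at every odd `p`, see its
module docstring):

* §1 `chiEigenSelmerIn_eq_eigenSelmerGroupOver` (**`rfl`**) and `ChiEigenSelmerInDualData.toEigen`:
  additive-p2's `F`-level eigen datum (`Additive/ChiEigenPrimeToPDescentDual.lean`) IS a Literature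
  `EigenSelmerDualData` (`Literature/…/IwasawaSelmerEigen.lean`) at `(ker κ ⊓ galRange K ⊓ U, ker κ,
  χ_K)` — the input slot of the general-`p` reading-facts
  `Wuthrich2014.thm16_halfEigenCharIdeal_dvd_cyclotomicPrime` /
  `Wuthrich2014.kato_halfEigenCharIdeal_dvd_cyclotomicPrime_of_surjective`;
* §2 fields: `exists_quadraticField_sq_eq` (`ℚ(√c)` as Mathlib's `QuadraticAlgebra ℚ c 0`, exactly as
  the tree's `Quadratic.exists_numberField_discr_eq`), `not_sq_eq_pStar` (`p* = (−1)^{(p−1)/2}p` is not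
  a rational square: sign, resp. odd `p`-adic valuation), `exists_isCyclotomicExtension`
  (`CyclotomicField p ℚ`);
* §3 `exists_unit_constantCoeff_of_eq_C_mul_prime` (from `ι g = C(uϖ)·B`, `B(0) = e·S` to
  `g(0) = (ue)·ϖ·S`) and `exists_halfBranchMult_even/odd`: for `V` MULTIPLICATIVE at `p`, the branch
  `B` of the general facts' disjunction (one-term measure, `a = a_p = ±1`, PLUS/MINUS by the parity of
  `(p−1)/2`) with `B(0)` a unit times `∑(a/p)[a/p]^±_f` (additive-p4's
  `constantCoeff_padicLFunction[Plus]BranchMult_half[_of_[non]split]`, MTT §I.13–I.14).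

References: Mazur–Tate–Teitelbaum 1986 [MazurTateTeitelbaum1986Invent] §I.10, §I.13–I.14; Greenberg
LNM 1716 [GreenbergLNM1716] §5 p. 143; Wuthrich 2014 [Wuthrich2014] §3 p. 390.
-/

noncomputable section

open scoped Classical MatrixGroups ModularForm

namespace Summit.BirchSwinnertonDyer.Rank1Residual.AdditivePotMult

open CongruenceSubgroup WeierstrassCurve Literature.NumberTheory.EllipticCurves
  Literature.NumberTheory.EllipticCurves.ModularForms
  Literature.NumberTheory.EllipticCurves.Rank1Residual Literature.NumberTheory.GaloisRepresentations
  Additive Polynomial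

/-! ## §1 The `F`-level eigen datum IS a Literature eigen-dual datum -/

section ToEigenIn

variable (V : WeierstrassCurve ℚ) (K : Type) [Field K] [NumberField K] {p : ℕ} [Fact p.Prime]
  (κ : ZpExtension ℚ p) [(galRange (K := ℚ) K).Normal]
  (U : Subgroup (Field.absoluteGaloisGroup ℚ)) [U.Normal] (γ : Field.absoluteGaloisGroup ℚ)

/-- additive-p2's `chiEigenSelmerIn V K p κ U` IS the Literature `eigenSelmerGroupOver` at
`(H, H', ε) = (ker κ ⊓ Gal(ℚ̄/K) ⊓ U, ker κ, χ_K)`. [folklore] -/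
theorem chiEigenSelmerIn_eq_eigenSelmerGroupOver :
    chiEigenSelmerIn V K p κ U =
      V.eigenSelmerGroupOver p (κ.kerSubgroup ⊓ galRange (K := ℚ) K ⊓ U) κ.kerSubgroup
        (fun g ↦ if g ∈ galRange (K := ℚ) K then 1 else -1) :=
  rfl

/-- **A `ChiEigenSelmerInDualData V K κ U γ` IS a Literature `EigenSelmerDualData`** with the SAME
underlying `Λ`-module. [folklore] -/
def ChiEigenSelmerInDualData.toEigen (D : ChiEigenSelmerInDualData V K κ U γ) :
    V.EigenSelmerDualData p (κ.kerSubgroup ⊓ galRange (K := ℚ) K ⊓ U) κ.kerSubgroup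
      (fun g ↦ if g ∈ galRange (K := ℚ) K then 1 else -1) γ where
  X := D.X
  conj_mem := fun _ ht ↦ conjH1_mem_chiEigenSelmerIn γ ht
  toDual := D.toDual
  bijective := D.bijective
  toDual_T_smul := D.toDual_T_smul
  toDual_C_smul := D.toDual_C_smul

/-- Same module. [folklore] -/
theorem ChiEigenSelmerInDualData.toEigen_X (D : ChiEigenSelmerInDualData V K κ U γ) :
    (ChiEigenSelmerInDualData.toEigen V K κ U γ D).X = D.X :=
  rfl

end ToEigenIn

/-! ## §2 Fields: `ℚ(√c)` for a non-square `c`, and `ℚ(ζ_p)` -/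

section Fields

/-- A quadratic number field `ℚ(√c)` with a square root `θ ∉ ℚ` of a non-square rational `c`
(Mathlib's `QuadraticAlgebra ℚ c 0`). [folklore] -/
theorem exists_quadraticField_sq_eq {c : ℚ} (hc : ∀ r : ℚ, r ^ 2 ≠ c) :
    ∃ (K : Type) (_ : Field K) (_ : NumberField K), Module.finrank ℚ K = 2 ∧
      ∃ θ : K, θ ∉ Set.range (algebraMap ℚ K) ∧ θ ^ 2 = algebraMap ℚ K c := by
  haveI : Fact (∀ r : ℚ, r ^ 2 ≠ c + 0 * r) := ⟨fun r h => hc r (by rw [h]; ring)⟩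
  let L := QuadraticAlgebra ℚ c 0
  haveI : NumberField L := NumberField.of_module_finite ℚ L
  have h2L : Module.finrank ℚ L = 2 := by convert QuadraticAlgebra.finrank_eq_two c (0 : ℚ)
  have hω : (QuadraticAlgebra.omega : L) ^ 2 = algebraMap ℚ L c := by
    have h := QuadraticAlgebra.omega_mul_omega_eq_add (a := c) (b := (0 : ℚ))
    rw [zero_smul, add_zero] at h
    rw [sq, h, Algebra.algebraMap_eq_smul_one]
  have hωK : (QuadraticAlgebra.omega : L) ∉ Set.range (algebraMap ℚ L) := by
    rintro ⟨r, h⟩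
    have him := congrArg QuadraticAlgebra.im h
    rw [QuadraticAlgebra.omega_im] at him
    have : (algebraMap ℚ L r).im = 0 := by
      rw [show algebraMap ℚ L r = (r : L) from rfl]
      rfl
    rw [this] at him
    exact zero_ne_one him
  exact ⟨L, inferInstance, inferInstance, h2L, QuadraticAlgebra.omega, hωK, hω⟩

/-- `p* = (−1)^{(p−1)/2} p` is not a rational square (`p` prime). [folklore] -/
theorem not_sq_eq_pStar (p : ℕ) [hp : Fact p.Prime] (r : ℚ) :
    r ^ 2 ≠ ((-1 : ℚ) ^ (p / 2) * p) := by
  intro h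
  -- `|r|² = p`: compare `p`-adic valuations (odd on the right, even on the left)
  have hp' := hp.out
  have habs : r ^ 2 = (p : ℚ) ∨ r ^ 2 = -(p : ℚ) := by
    rcases neg_one_pow_eq_or ℚ (p / 2) with h1 | h1 <;> rw [h1] at h
    · left; rw [h, one_mul]
    · right; rw [h, neg_one_mul]
  have hsq : r ^ 2 = (p : ℚ) := by
    rcases habs with h1 | h1
    · exact h1
    · exfalso
      have h0 : (0 : ℚ) ≤ r ^ 2 := sq_nonneg r
      rw [h1] at h0
      have : (0 : ℚ) < p := by exact_mod_cast hp'.pos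
      linarith
  have hr0 : r ≠ 0 := by
    rintro rfl
    rw [zero_pow two_ne_zero] at hsq
    exact hp'.ne_zero (by exact_mod_cast hsq.symm)
  have hv := congrArg (padicValRat p) hsq
  rw [padicValRat.pow r, padicValRat.self hp'.one_lt] at hv
  omega

/-- A number field `F = ℚ(ζ_p)` exists (e.g. `CyclotomicField p ℚ`). [folklore] -/
theorem exists_isCyclotomicExtension (p : ℕ) [hp : Fact p.Prime] :
    ∃ (F : Type) (_ : Field F) (_ : NumberField F), IsCyclotomicExtension {p} ℚ F :=
  haveI : NeZero ((p : ℕ) : ℚ) := ⟨Nat.cast_ne_zero.mpr hp.out.ne_zero⟩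
  ⟨CyclotomicField p ℚ, inferInstance, inferInstance, CyclotomicField.isCyclotomicExtension p ℚ⟩

end Fields

/-! ## §3 The half branch of a `p`-multiplicative curve and its constant term -/

section HalfBranch

variable (p : ℕ) [hp : Fact p.Prime]

/-- From `ι g = C(u ϖ) · L` and `L(0) = e · S` to `g(0) = (u e) · ϖ · S`. [folklore] -/
theorem exists_unit_constantCoeff_of_eq_C_mul_prime {g : IwasawaAlgebra p} {u e : ℤ_[p]ˣ} {ϖ S : ℚ}
    {L : PowerSeries ℚ_[p]}
    (hg : iwasawaToPowerSeries p g = PowerSeries.C (((u : ℤ_[p]) : ℚ_[p]) * (ϖ : ℚ_[p])) * L)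
    (hL : PowerSeries.constantCoeff L = ((e : ℤ_[p]) : ℚ_[p]) * (S : ℚ_[p])) :
    ∃ u' : ℤ_[p]ˣ, ((PowerSeries.constantCoeff g : ℤ_[p]) : ℚ_[p]) =
      ((u' : ℤ_[p]) : ℚ_[p]) * (ϖ : ℚ_[p]) * (S : ℚ_[p]) := by
  refine ⟨u * e, ?_⟩
  have h0 := congrArg PowerSeries.constantCoeff hg
  rw [map_mul, PowerSeries.constantCoeff_C, hL, constantCoeff_iwasawaToPowerSeries] at h0
  rw [h0, Units.val_mul, PadicInt.coe_mul]
  ring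

/-- **The half branch of a `p`-MULTIPLICATIVE curve, EVEN case (`p ≡ 1 (mod 4)`), and its value at
`T = 0`**: in the exact disjunctive shape of the general-`p` reading-facts (the good-ordinary disjunct
is not used), `B = padicLFunctionPlusBranchMult f a ((p−1)/2)` with `a = a_p = ±1` and
`B(0) = ±∑(a/p)[a/p]⁺_f` (additive-p4's `constantCoeff_padicLFunctionPlusBranchMult_half`; MTT
§I.13–I.14). [cite: MazurTateTeitelbaum1986Invent, §I.10, §I.13–I.14] -/
theorem exists_halfBranchMult_even (hp2 : p ≠ 2) (heven : Even (p / 2)) {V : WeierstrassCurve ℚ}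
    [V.IsElliptic] [V.IsGloballyMinimal] {N : ℕ} [NeZero N] {f : CuspForm (Gamma0 N) 2}
    (hV : Mult V p) (hf : IsNewformOf V f) :
    ∃ (B : PowerSeries ℚ_[p]) (e : ℤ_[p]ˣ),
      ((IsOrdinaryAt V p ∧
          B = if Even (p / 2) then padicLFunctionBranch f ((unitRoot V p : ℤ_[p]) : ℚ_[p]) (p / 2)
            else padicLFunctionMinusBranch f ((unitRoot V p : ℤ_[p]) : ℚ_[p]) (p / 2)) ∨
        (V.HasSplitMultiplicativeReductionAtPrime p ∧
          B = if Even (p / 2) then padicLFunctionPlusBranchMult f (1 : ℚ_[p]) (p / 2)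
            else padicLFunctionMinusBranchMult f (1 : ℚ_[p]) (p / 2)) ∨
        (V.HasMultiplicativeReductionAtPrime p ∧ ¬ V.HasSplitMultiplicativeReductionAtPrime p ∧
          B = if Even (p / 2) then padicLFunctionPlusBranchMult f (-1 : ℚ_[p]) (p / 2)
            else padicLFunctionMinusBranchMult f (-1 : ℚ_[p]) (p / 2))) ∧
      PowerSeries.constantCoeff B = ((e : ℤ_[p]) : ℚ_[p]) * (legendrePlusSymbolSum f p : ℚ_[p]) := by
  by_cases hs : V.HasSplitMultiplicativeReductionAtPrime p
  · obtain ⟨hap, -⟩ := hf.cuspCoeff_eq_one_and_sq_of_split hs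
    have hpN := hf.dvd_level_of_split hs
    have h := constantCoeff_padicLFunctionPlusBranchMult_half p hp2 hf.1 hf.coeffField_eq_bot hpN
      (ap := 1) (by exact_mod_cast hap) (by norm_num)
    refine ⟨_, 1, Or.inr (Or.inl ⟨hs, rfl⟩), ?_⟩
    push_cast at h
    rw [if_pos heven, h]; push_cast; ring
  · obtain ⟨hap, hpN⟩ := hf.cuspCoeff_eq_neg_one_and_dvd_of_nonsplit hV hs
    have h := constantCoeff_padicLFunctionPlusBranchMult_half p hp2 hf.1 hf.coeffField_eq_bot hpN
      (ap := -1) (by exact_mod_cast hap) (by norm_num)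
    refine ⟨_, -1, Or.inr (Or.inr ⟨hV, hs, rfl⟩), ?_⟩
    push_cast at h
    rw [if_pos heven, h]; push_cast; ring

/-- **The half branch of a `p`-MULTIPLICATIVE curve, ODD case (`p ≡ 3 (mod 4)`), and its value at
`T = 0`**: `B = padicLFunctionMinusBranchMult f a ((p−1)/2)`, `B(0) = ±∑(a/p)[a/p]⁻_f` (additive-p4's
`constantCoeff_padicLFunctionMinusBranchMult_half_of_[non]split`; MTT §I.13–I.14).
[cite: MazurTateTeitelbaum1986Invent, §I.10, §I.13–I.14] -/
theorem exists_halfBranchMult_odd (hp2 : p ≠ 2) (hodd : ¬ Even (p / 2)) {V : WeierstrassCurve ℚ}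
    [V.IsElliptic] [V.IsGloballyMinimal] {N : ℕ} [NeZero N] {f : CuspForm (Gamma0 N) 2}
    (hV : Mult V p) (hf : IsNewformOf V f) :
    ∃ (B : PowerSeries ℚ_[p]) (e : ℤ_[p]ˣ),
      ((IsOrdinaryAt V p ∧
          B = if Even (p / 2) then padicLFunctionBranch f ((unitRoot V p : ℤ_[p]) : ℚ_[p]) (p / 2)
            else padicLFunctionMinusBranch f ((unitRoot V p : ℤ_[p]) : ℚ_[p]) (p / 2)) ∨
        (V.HasSplitMultiplicativeReductionAtPrime p ∧
          B = if Even (p / 2) then padicLFunctionPlusBranchMult f (1 : ℚ_[p]) (p / 2)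
            else padicLFunctionMinusBranchMult f (1 : ℚ_[p]) (p / 2)) ∨
        (V.HasMultiplicativeReductionAtPrime p ∧ ¬ V.HasSplitMultiplicativeReductionAtPrime p ∧
          B = if Even (p / 2) then padicLFunctionPlusBranchMult f (-1 : ℚ_[p]) (p / 2)
            else padicLFunctionMinusBranchMult f (-1 : ℚ_[p]) (p / 2))) ∧
      PowerSeries.constantCoeff B = ((e : ℤ_[p]) : ℚ_[p]) * (legendreMinusSymbolSum f p : ℚ_[p]) := by
  by_cases hs : V.HasSplitMultiplicativeReductionAtPrime p
  · refine ⟨_, 1, Or.inr (Or.inl ⟨hs, rfl⟩), ?_⟩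
    rw [if_neg hodd, constantCoeff_padicLFunctionMinusBranchMult_half_of_split p hp2 V hs hf]
    push_cast; ring
  · refine ⟨_, -1, Or.inr (Or.inr ⟨hV, hs, rfl⟩), ?_⟩
    rw [if_neg hodd, constantCoeff_padicLFunctionMinusBranchMult_half_of_nonsplit p hp2 V hV hs hf]
    push_cast; ring

end HalfBranch


end Summit.BirchSwinnertonDyer.Rank1Residual.AdditivePotMult

end
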